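import Summits.HubbardSuperconductivity.HubbardSuperconductivity.Theses.JosephsonMirror
import Summits.HubbardSuperconductivity.HubbardSuperconductivity.Theorems.JosephsonMirrorJmInterchangeRateForm
import Summits.HubbardSuperconductivity.HubbardSuperconductivity.Theorems.JosephsonMirrorJmInterchangeExactResidues
import Summits.HubbardSuperconductivity.HubbardSuperconductivity.Theorems.JosephsonMirrorJmPairBridgeGenericCoupling
import Summits.HubbardSuperconductivity.HubbardSuperconductivity.Theorems.JosephsonMirrorPairBridgeGivesGain

/-!
# Crux `JmInterchange` (stmt-HubbardSuperconductivity-2227) — STRATEGY CENSUS, typed part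

Companion of `Cruxes/JmInterchange/STRATEGY-CENSUS.md` (crux-strategist WALL-BREAKER seat
`planner-cstrat-stmt-HubbardSuperconductivity-2227-p1-0`, 2026-08-17).  This file TYPES the statements the census
discusses and CERTIFIES, from theorems already in the tree, the one claim of the census that is a theorem rather
than a judgement — the COLLAPSE LEMMA of §Strengthen (S2):

* `floorBridge_of_uniformGain` — if the Josephson gain of the window double has UNIFORM ONSET
  (`∃ L₀ ∀ J ∈ (0, J₀] ∀ even L ≥ L₀ : a J L² ≤ E_L(0) - E_L(J)`, i.e. the quantifiers of the filed hypothesis with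
  `∃ L₀` and `∀ J` interchanged), then the crux's conclusion `FloorBridge U δ` holds, at EVERY `(U, δ)` — with no
  isolation / gap hypothesis whatsoever.  Proof: in each volume the two sector floors `G(N_L,0)`, `G(N_L-2,0)` are
  isolated at SOME positive scale `γ(L)` (finite dimension: `stub_floorGap`, `exists_twoFloorIsolation` below);
  uniform onset lets us read the gain at the mesoscopic coupling `J = min J₀ (κ₀(a) γ(L) / L²)` of THAT volume, and
  `floorBridge_of_mesoscopicGain` (p129634, lead c2) returns the floor pair with `a' = a/4`.
  Together with the landed converse `jmPairBridgeGivesGain_proof` (a floor pair ⇒ gain for ALL `J ≥ 0`, onset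
  uniform) this closes the dictionary:  **uniform-onset Josephson cusp ⟺ Penrose–Onsager floor bridge**, volume by
  volume.  Consequence recorded in the census: every restatement of the route that makes the interchange item
  PROVABLE (uniform onset, rate form (B′), floor-order form (A)) turns the bet `JmCusp` into a statement that
  already CONTAINS the floor bridge, i.e. the thesis X (`JmPairBridge`) plus a rigidity — the Josephson mirror is a
  dictionary for X, not a reduction of X; only the filed fixed-`J` (energy-density) form is strictly softer, and its
  interchange is the Lieb–Seiringer–Yngvason / Tasaki open converse (`jmInterchange_iff_reachesFloor_and_bridges`).

The remaining declarations are the census's typed candidates (no claim of truth): `UniformGainHyp`, the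
restatement bets `JmCuspUniform` / `JmCuspRate` (B′) / `JmFloorOrderBet` (A′), the strengthenings
`IntervalInterchange` (S3) and `OrderGapAt` (S4, with the two-line proof that it CONTAINS floor order,
`floorOrder_of_orderGap`).  No `sorry`.  No new mathematics beyond the corollary.
-/

set_option linter.dupNamespace false
set_option linter.unusedVariables false

namespace Summit.HubbardSuperconductivity.HubbardSuperconductivity.Cruxes.JmInterchange.StrategyCensus

open Literature.MathematicalPhysics.QuantumLattice Filter
open scoped Matrix
open Summit.HubbardSuperconductivity.HubbardSuperconductivity.Theses.JosephsonMirror (JmInterchange JmPairBridge JmCusp)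
open Summit.HubbardSuperconductivity.HubbardSuperconductivity.Theorems
open Summit.HubbardSuperconductivity.HubbardSuperconductivity.Theorems.JosephsonMirror

noncomputable section

/-- The summit's particle number `N_L = 2⌊(1-δ)L²/2⌋`. -/
def statN (δ : ℝ) (L : ℕ) : ℕ := 2 * ⌊(1 - δ) * (L : ℝ) ^ 2 / 2⌋₊

/-! ## §1  The crux's hypothesis and conclusion, verbatim, and the uniform-onset hypothesis -/

/-- The HYPOTHESIS of `JmInterchange` at `(U, δ, a, J₀)`, verbatim (onset `L₀ = L₀(J)`). -/
def GainHyp (U δ a J₀ : ℝ) : Prop :=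
  ∀ J ∈ Set.Ioc (0:ℝ) J₀, ∃ L₀ : ℕ, ∀ (L : ℕ) [NeZero L], Even L → L₀ ≤ L → (let ι : Type := Finset (Literature.MathematicalPhysics.QuantumLattice.Orb (Literature.MathematicalPhysics.QuantumLattice.FermionTorus 2 L)); let N : ℕ := 2 * ⌊(1 - δ) * (L : ℝ) ^ 2 / 2⌋₊; let H : Matrix ι ι ℂ := Literature.MathematicalPhysics.QuantumLattice.hubbardTorus 2 L 1 U; let μ : ℝ := (H.minEnergyOn (Literature.MathematicalPhysics.QuantumLattice.szSector N 0) - H.minEnergyOn (Literature.MathematicalPhysics.QuantumLattice.szSector (N - 2) 0)) / 2; let A : Matrix ι ι ℂ := Literature.MathematicalPhysics.QuantumLattice.hubbardTorusWith 2 L 1 U μ; let D : Matrix ι ι ℂ := ((L : ℂ))⁻¹ • Literature.MathematicalPhysics.QuantumLattice.pairField Literature.MathematicalPhysics.QuantumLattice.dWaveFormFactor L; let Hd : ℝ → Matrix (ι × ι) (ι × ι) ℂ := fun J => Matrix.kroneckerMap (fun a b : ℂ => a * b) A 1 + Matrix.kroneckerMap (fun a b : ℂ => a * b) 1 (Matrix.transpose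 A) - (J : ℂ) • (Matrix.kroneckerMap (fun a b : ℂ => a * b) D (Matrix.transpose (Matrix.conjTranspose D)) + Matrix.kroneckerMap (fun a b : ℂ => a * b) (Matrix.conjTranspose D) (Matrix.transpose D)); let good : ι × ι → Prop := fun p => ((p.1.card = N ∧ p.2.card = N) ∨ (p.1.card = N - 2 ∧ p.2.card = N - 2)) ∧ (p.1.filter (fun o => (ofLex o).2 = 0)).card = (p.1.filter (fun o => (ofLex o).2 = 1)).card ∧ (p.2.filter (fun o => (ofLex o).2 = 0)).card = (p.2.filter (fun o => (ofLex o).2 = 1)).card; let S : Submodule ℂ (ι × ι → ℂ) := ⨅ (p : ι × ι) (_ : ¬ good p), LinearMap.ker (LinearMap.proj (R := ℂ) (φ := fun _ : ι × ι => ℂ) p); let E : ℝ → ℝ := fun J => (Hd J).minEnergyOn S; a * J * (L : ℝ) ^ 2 ≤ E 0 - E J)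

/-- The CONCLUSION of `JmInterchange` at `(U, δ)`, verbatim. -/
def FloorBridge (U δ : ℝ) : Prop :=
  ∃ a' : ℝ, 0 < a' ∧ ∃ L₀ : ℕ, ∀ (L : ℕ) [NeZero L], Even L → L₀ ≤ L → ∃ φ χ : Literature.MathematicalPhysics.QuantumLattice.Fock (Literature.MathematicalPhysics.QuantumLattice.Orb (Literature.MathematicalPhysics.QuantumLattice.FermionTorus 2 L)), Literature.MathematicalPhysics.QuantumLattice.IsGroundStateInSector (Literature.MathematicalPhysics.QuantumLattice.hubbardTorus 2 L 1 U) (2 * ⌊(1 - δ) * (L : ℝ) ^ 2 / 2⌋₊) 0 φ ∧ star φ ⬝ᵥ φ = 1 ∧ Literature.MathematicalPhysics.QuantumLattice.IsGroundStateInSector (Literature.MathematicalPhysics.QuantumLattice.hubbardTorus 2 L 1 U) (2 * ⌊(1 - δ) * (L : ℝ) ^ 2 / 2⌋₊ - 2) 0 χ ∧ star χ ⬝ᵥ χ = 1 ∧ a' * (L : ℝ) ^ 4 ≤ ‖star χ ⬝ᵥ Matrix.mulVec (Literature.MathematicalPhysics.QuantumLattice.pairField Literature.MathematicalPhysics.QuantumLattice.dWaveFormFactor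 L) φ‖ ^ 2

/-- The crux IS `∀ (U, δ, a, J₀), GainHyp → FloorBridge` (definitional). -/
theorem jmInterchange_iff_pointwise :
    JmInterchange ↔ ∀ (U δ a J₀ : ℝ), 0 < U → δ ∈ Set.Ioo (0:ℝ) (1 / 2) → 0 < a → 0 < J₀ →
      GainHyp U δ a J₀ → FloorBridge U δ :=
  Iff.rfl

/-- UNIFORM-ONSET Josephson gain at `(U, δ, a, J₀)`: the filed hypothesis with `∃ L₀` moved in front of `∀ J`. -/
def UniformGainHyp (U δ a J₀ : ℝ) : Prop :=
  ∃ L₀ : ℕ, ∀ J ∈ Set.Ioc (0:ℝ) J₀, ∀ (L : ℕ) [NeZero L], Even L → L₀ ≤ L → (let ι : Type := Finset (Literature.MathematicalPhysics.QuantumLattice.Orb (Literature.MathematicalPhysics.QuantumLattice.FermionTorus 2 L)); let N : ℕ := 2 * ⌊(1 - δ) * (L : ℝ) ^ 2 / 2⌋₊; let H : Matrix ι ι ℂ := Literature.MathematicalPhysics.QuantumLattice.hubbardTorus 2 L 1 U; let μ : ℝ := (H.minEnergyOn (Literature.MathematicalPhysics.QuantumLattice.szSector N 0) - H.minEnergyOn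 (Literature.MathematicalPhysics.QuantumLattice.szSector (N - 2) 0)) / 2; let A : Matrix ι ι ℂ := Literature.MathematicalPhysics.QuantumLattice.hubbardTorusWith 2 L 1 U μ; let D : Matrix ι ι ℂ := ((L : ℂ))⁻¹ • Literature.MathematicalPhysics.QuantumLattice.pairField Literature.MathematicalPhysics.QuantumLattice.dWaveFormFactor L; let Hd : ℝ → Matrix (ι × ι) (ι × ι) ℂ := fun J => Matrix.kroneckerMap (fun a b : ℂ => a * b) A 1 + Matrix.kroneckerMap (fun a b : ℂ => a * b) 1 (Matrix.transpose A) - (J : ℂ) • (Matrix.kroneckerMap (fun a b : ℂ => a * b) D (Matrix.transpose (Matrix.conjTranspose D)) + Matrix.kroneckerMap (fun a b : ℂ => a * b) (Matrix.conjTranspose D) (Matrix.transpose D)); let good : ι × ι → Prop := fun p => ((p.1.card = N ∧ p.2.card = N) ∨ (p.1.card = N - 2 ∧ p.2.card = N - 2)) ∧ (p.1.filter (fun o => (ofLex o).2 = 0)).card = (p.1.filter (fun o => (ofLex o).2 = 1)).card ∧ (p.2.filter (fun o => (ofLex o).2 = 0)).card = (p.2.filter (fun o => (ofLex o).2 = 1)).card;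 let S : Submodule ℂ (ι × ι → ℂ) := ⨅ (p : ι × ι) (_ : ¬ good p), LinearMap.ker (LinearMap.proj (R := ℂ) (φ := fun _ : ι × ι => ℂ) p); let E : ℝ → ℝ := fun J => (Hd J).minEnergyOn S; a * J * (L : ℝ) ^ 2 ≤ E 0 - E J)

/-- Uniform onset is (trivially) at least the filed hypothesis. -/
theorem gainHyp_of_uniformGainHyp (U δ a J₀ : ℝ) (h : UniformGainHyp U δ a J₀) : GainHyp U δ a J₀ := by
  obtain ⟨L₀, hL₀⟩ := h
  intro J hJ
  exact ⟨L₀, fun L _ hE hL => hL₀ J hJ L hE hL⟩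

/-! ## §2  The collapse lemma: uniform onset ⇒ floor bridge, unconditionally -/

/-- In every volume, for every `U` and `N`, the two sector floors `G(N, 0)` and `G(N - 2, 0)` of the Hubbard torus
are isolated inside their sectors at SOME positive scale `γ` (the smaller of the two second-eigenvalue gaps;
finite dimension).  From `stub_floorGap` (Theorems/JosephsonMirrorJmPairBridgeFloorGap). [folklore] -/
theorem exists_twoFloorIsolation (L : ℕ) [NeZero L] (U : ℝ) (N : ℕ) :
    ∃ γ : ℝ, 0 < γ ∧ ∀ n : ℕ, (n = N ∨ n = N - 2) → ∀ w : Fock (Orb (FermionTorus 2 L)), w ∈ szSector n 0 →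
      (∀ g : Fock (Orb (FermionTorus 2 L)), IsGroundStateInSector (hubbardTorus 2 L 1 U) n 0 g → star g ⬝ᵥ w = 0) →
        ((hubbardTorus 2 L 1 U).minEnergyOn (szSector n 0) + γ) * (star w ⬝ᵥ w).re ≤
          (star w ⬝ᵥ (hubbardTorus 2 L 1 U *ᵥ w)).re := by
  classical
  set H := hubbardTorus 2 L 1 U with hHdef
  have hherm : Hᴴ = H := (LiebThm1.hamiltonian_isHermitian (fermionTorusGraph 2 L) 1 U).eq
  -- one sector at a time
  have hsec : ∀ n : ℕ, ∃ γ : ℝ, 0 < γ ∧ ∀ w : Fock (Orb (FermionTorus 2 L)), w ∈ szSector n 0 →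
      (∀ g : Fock (Orb (FermionTorus 2 L)), IsGroundStateInSector H n 0 g → star g ⬝ᵥ w = 0) →
        (H.minEnergyOn (szSector n 0) + γ) * (star w ⬝ᵥ w).re ≤ (star w ⬝ᵥ (H *ᵥ w)).re := by
    intro n
    set K : Submodule ℂ (Fock (Orb (FermionTorus 2 L))) := szSector n 0 with hKdef
    have hinv : ∀ v ∈ K, H *ᵥ v ∈ K := fun v hv => hubbardTorus_mulVec_mem_szSector 1 U hv
    have hm : ∀ v ∈ K, H.minEnergyOn K * (star v ⬝ᵥ v).re ≤ (star v ⬝ᵥ H *ᵥ v).re :=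
      fun v hv => minEnergyOn_mul_re_le H K hv
    obtain ⟨μ, hμ, hgap, -⟩ := stub_floorGap H hherm K hinv (H.minEnergyOn K) hm
    refine ⟨μ - H.minEnergyOn K, sub_pos.mpr hμ, fun w hw horth => ?_⟩
    have hw' : ∀ ψ ∈ K, H *ᵥ ψ = ((H.minEnergyOn K : ℝ) : ℂ) • ψ → star ψ ⬝ᵥ w = 0 := by
      intro ψ hψ hHψ
      by_cases h0 : ψ = 0
      · rw [h0, star_zero, zero_dotProduct]
      · exact horth ψ ⟨hψ, h0, hHψ⟩
    have := hgap w hw hw'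
    rw [add_sub_cancel]
    exact this
  obtain ⟨γ₁, hγ₁, h₁⟩ := hsec N
  obtain ⟨γ₂, hγ₂, h₂⟩ := hsec (N - 2)
  refine ⟨min γ₁ γ₂, lt_min hγ₁ hγ₂, ?_⟩
  rintro n (rfl | rfl) w hw horth
  · have h := h₁ w hw horth
    have hww : 0 ≤ (star w ⬝ᵥ w).re := EigenvalueContinuation.re_star_dotProduct_self_nonneg w
    have : (H.minEnergyOn (szSector n 0) + min γ₁ γ₂) * (star w ⬝ᵥ w).re ≤
        (H.minEnergyOn (szSector n 0) + γ₁) * (star w ⬝ᵥ w).re :=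
      mul_le_mul_of_nonneg_right (by linarith [min_le_left γ₁ γ₂]) hww
    exact this.trans h
  · have h := h₂ w hw horth
    have hww : 0 ≤ (star w ⬝ᵥ w).re := EigenvalueContinuation.re_star_dotProduct_self_nonneg w
    have : (H.minEnergyOn (szSector (N - 2) 0) + min γ₁ γ₂) * (star w ⬝ᵥ w).re ≤
        (H.minEnergyOn (szSector (N - 2) 0) + γ₂) * (star w ⬝ᵥ w).re :=
      mul_le_mul_of_nonneg_right (by linarith [min_le_right γ₁ γ₂]) hww
    exact this.trans h

/-- **COLLAPSE LEMMA (census S2).**  Uniform-onset Josephson gain ⇒ the crux's conclusion, at every `(U, δ)` and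
without any isolation hypothesis: read the gain at the mesoscopic coupling of each volume
(`floorBridge_of_mesoscopicGain`, p129634) using the finite-dimensional isolation `exists_twoFloorIsolation`.
With `jmPairBridgeGivesGain_proof` (bridge ⇒ gain for all `J ≥ 0`): uniform-onset cusp ⟺ floor bridge. [folklore] -/
theorem floorBridge_of_uniformGain (U δ a J₀ : ℝ) (hδ : δ ∈ Set.Ioo (0:ℝ) (1 / 2)) (ha : 0 < a) (hJ₀ : 0 < J₀)
    (hG : UniformGainHyp U δ a J₀) : FloorBridge U δ := by
  obtain ⟨κ₀, hκ₀, hmeso⟩ := floorBridge_of_mesoscopicGain a ha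
  obtain ⟨L₀, hL₀⟩ := hG
  refine ⟨a / 4, by positivity, max L₀ 4, fun L _ hE hL => ?_⟩
  have hL₀L : L₀ ≤ L := le_trans (le_max_left _ _) hL
  have hL4 : 4 ≤ L := le_trans (le_max_right _ _) hL
  obtain ⟨γ, hγ, hiso⟩ := exists_twoFloorIsolation L U (2 * ⌊(1 - δ) * (L : ℝ) ^ 2 / 2⌋₊)
  have hL0 : (0 : ℝ) < L := by
    have : (4 : ℝ) ≤ L := by exact_mod_cast hL4
    linarith
  have hL2 : (0 : ℝ) < (L : ℝ) ^ 2 := by positivity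
  -- the mesoscopic coupling of this volume
  set J : ℝ := min J₀ (κ₀ * γ / (L : ℝ) ^ 2) with hJdef
  have hJpos : 0 < J := lt_min hJ₀ (by positivity)
  have hJle : J ≤ J₀ := min_le_left _ _
  have hJγ : J * (L : ℝ) ^ 2 ≤ κ₀ * γ := by
    have : J ≤ κ₀ * γ / (L : ℝ) ^ 2 := min_le_right _ _
    rwa [le_div_iff₀ hL2] at this
  have hgain := hL₀ J ⟨hJpos, hJle⟩ L hE hL₀L
  exact hmeso L U δ J γ hE hL4 hδ hJpos hγ hJγ hiso hgain

/-- The same, packaged as the UNIFORM-ONSET INTERCHANGE `∀ (U, δ, a, J₀)` — a THEOREM, in contrast with the filed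
fixed-`J` interchange `JmInterchange ↔ (R1 ∧ R2′)` (`jmInterchange_iff_reachesFloor_and_bridges`). [folklore] -/
theorem uniformOnsetInterchange :
    ∀ (U δ a J₀ : ℝ), 0 < U → δ ∈ Set.Ioo (0:ℝ) (1 / 2) → 0 < a → 0 < J₀ →
      UniformGainHyp U δ a J₀ → FloorBridge U δ :=
  fun U δ a J₀ _ hδ ha hJ₀ hG => floorBridge_of_uniformGain U δ a J₀ hδ ha hJ₀ hG

/-! ## §3  Typed restatement candidates (for the tenure planner / the human; NO claim of truth) -/

/-- Eventual simplicity of the `(N_L, S^z = 0)` floor (second clause of the filed `JmCusp`, verbatim shape). -/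
def EventualSimplicity (U δ : ℝ) : Prop :=
  ∃ L₀ : ℕ, ∀ (L : ℕ), Even L → L₀ ≤ L → ∀ φ φ' : Fock (Orb (FermionTorus 2 L)),
    IsGroundStateInSector (hubbardTorus 2 L 1 U) (statN δ L) 0 φ →
      IsGroundStateInSector (hubbardTorus 2 L 1 U) (statN δ L) 0 φ' → ∃ c : ℂ, φ' = c • φ

/-- (U) Uniform-onset bet: `∃ (U, δ, a, J₀)`, uniform-onset gain ∧ eventual simplicity.  By `floorBridge_of_uniformGain`
and `jmPairBridgeGivesGain_proof` its first conjunct IS the floor bridge: this bet ⟹ X with no interchange item left,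
and X ⟹ its first conjunct — it is X ∧ simplicity (COLLAPSE). -/
def JmCuspUniform : Prop :=
  ∃ U : ℝ, 0 < U ∧ ∃ δ ∈ Set.Ioo (0:ℝ) (1 / 2), ∃ a : ℝ, 0 < a ∧ ∃ J₀ : ℝ, 0 < J₀ ∧
    UniformGainHyp U δ a J₀ ∧ EventualSimplicity U δ

/-- Two-sector isolation at scale `γ_L` (line `Sketch` §5, verbatim). -/
def TwoSectorIsolation (U δ : ℝ) (γ : ℕ → ℝ) : Prop :=
  ∃ L₀ : ℕ, ∀ (L : ℕ) [NeZero L], Even L → L₀ ≤ L →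
    ∀ n : ℕ, (n = statN δ L ∨ n = statN δ L - 2) → ∀ w : Fock (Orb (FermionTorus 2 L)), w ∈ szSector n 0 →
      (∀ g : Fock (Orb (FermionTorus 2 L)), IsGroundStateInSector (hubbardTorus 2 L 1 U) n 0 g → star g ⬝ᵥ w = 0) →
        ((hubbardTorus 2 L 1 U).minEnergyOn (szSector n 0) + γ L) * (star w ⬝ᵥ w).re ≤
          (star w ⬝ᵥ (hubbardTorus 2 L 1 U *ᵥ w)).re

/-- Mesoscopic Josephson gain at couplings `J_L` (line `Sketch` §5, verbatim). -/
def MesoscopicGain (U δ a : ℝ) (J : ℕ → ℝ) : Prop :=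
  ∃ L₀ : ℕ, ∀ (L : ℕ) [NeZero L], Even L → L₀ ≤ L → (let ι : Type := Finset (Literature.MathematicalPhysics.QuantumLattice.Orb (Literature.MathematicalPhysics.QuantumLattice.FermionTorus 2 L)); let N : ℕ := 2 * ⌊(1 - δ) * (L : ℝ) ^ 2 / 2⌋₊; let H : Matrix ι ι ℂ := Literature.MathematicalPhysics.QuantumLattice.hubbardTorus 2 L 1 U; let μ : ℝ := (H.minEnergyOn (Literature.MathematicalPhysics.QuantumLattice.szSector N 0) - H.minEnergyOn (Literature.MathematicalPhysics.QuantumLattice.szSector (N - 2) 0)) / 2; let A : Matrix ι ι ℂ := Literature.MathematicalPhysics.QuantumLattice.hubbardTorusWith 2 L 1 U μ; let D : Matrix ι ι ℂ := ((L : ℂ))⁻¹ • Literature.MathematicalPhysics.QuantumLattice.pairField Literature.MathematicalPhysics.QuantumLattice.dWaveFormFactor L; let Hd : ℝ → Matrix (ι × ι) (ι × ι) ℂ := fun J => Matrix.kroneckerMap (fun a b : ℂ => a * b) A 1 + Matrix.kroneckerMap (fun a b : ℂ => a * b) 1 (Matrix.transpose A) - (J : ℂ) • (Matrix.kroneckerMap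 (fun a b : ℂ => a * b) D (Matrix.transpose (Matrix.conjTranspose D)) + Matrix.kroneckerMap (fun a b : ℂ => a * b) (Matrix.conjTranspose D) (Matrix.transpose D)); let good : ι × ι → Prop := fun p => ((p.1.card = N ∧ p.2.card = N) ∨ (p.1.card = N - 2 ∧ p.2.card = N - 2)) ∧ (p.1.filter (fun o => (ofLex o).2 = 0)).card = (p.1.filter (fun o => (ofLex o).2 = 1)).card ∧ (p.2.filter (fun o => (ofLex o).2 = 0)).card = (p.2.filter (fun o => (ofLex o).2 = 1)).card; let S : Submodule ℂ (ι × ι → ℂ) := ⨅ (p : ι × ι) (_ : ¬ good p), LinearMap.ker (LinearMap.proj (R := ℂ) (φ := fun _ : ι × ι => ℂ) p); let E : ℝ → ℝ := fun J => (Hd J).minEnergyOn S; a * J L * (L : ℝ) ^ 2 ≤ E 0 - E (J L))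

/-- (B′) Rate-form bet (Lines/Sketch-dead.md recipe B′, typed): `∃ (U, δ, a, J_L, γ_L)`, `J_L L²/γ_L → 0`, two-sector
isolation, mesoscopic gain, simplicity.  Its interchange is the landed `rateFormInterchange`; under isolation the
mesoscopic gain ⟺ the floor bridge (p129634 + `jmPairBridgeGivesGain_proof`), so this bet = X ∧ isolation ∧ simplicity
(COLLAPSE, and by NegativeNotesIdeator5 §1 the isolation clause silently assumes a C₄-symmetric floor phase). -/
def JmCuspRate : Prop :=
  ∃ U : ℝ, 0 < U ∧ ∃ δ ∈ Set.Ioo (0:ℝ) (1 / 2), ∃ a : ℝ, 0 < a ∧ ∃ J γ : ℕ → ℝ,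
    (∀ L, 0 < J L) ∧ (∀ L, 0 < γ L) ∧ Tendsto (fun L : ℕ => J L * (L : ℝ) ^ 2 / γ L) atTop (nhds 0) ∧
      TwoSectorIsolation U δ γ ∧ MesoscopicGain U δ a J ∧ EventualSimplicity U δ

/-- Ground-floor order at `(U, δ)` (line `Sketch` §3, verbatim). -/
def FloorOrder (U δ : ℝ) : Prop :=
  ∃ c : ℝ, 0 < c ∧ ∃ L₀ : ℕ, ∀ (L : ℕ) [NeZero L], Even L → L₀ ≤ L →
    ∃ g : Fock (Orb (FermionTorus 2 L)), IsGroundStateInSector (hubbardTorus 2 L 1 U) (statN δ L) 0 g ∧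
      star g ⬝ᵥ g = 1 ∧
      c * (L : ℝ) ^ 4 ≤
        (star (pairField dWaveFormFactor L *ᵥ g) ⬝ᵥ (pairField dWaveFormFactor L *ᵥ g)).re

/-- (A′) Floor-order bet (recipe A with the bridge dropped, NegativeNotesIdeator5 §5(c)): `∃ (U, δ)`, floor order of ONE
ground-state sequence ∧ eventual simplicity.  It implies the summit directly (simplicity makes every unit ground state
`c • g`, `|c| = 1`; then `‖Δ_d ψ‖² ≥ c L⁴` feeds `JmTargetToSummit`'s bookkeeping without Cauchy–Schwarz) — and it is
the summit's `∃(U,δ) ∀ sequences` split as (some sequence) ∧ (simplicity): one crux, i.e. the target restated. -/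
def JmFloorOrderBet : Prop :=
  ∃ U : ℝ, 0 < U ∧ ∃ δ ∈ Set.Ioo (0:ℝ) (1 / 2), FloorOrder U δ ∧ EventualSimplicity U δ

/-- Zero-excess pair order at `(U, δ)` (line `Sketch` §1, verbatim): the single-layer EQUIVALENT of the filed hypothesis
(`hypGivesZEPO_of_pigeonhole` p106153, `zepoGivesHyp` p110212). -/
def ZeroExcessPairOrder (U δ : ℝ) : Prop :=
  ∃ c : ℝ, 0 < c ∧ ∀ ε : ℝ, 0 < ε → ∃ L₀ : ℕ, ∀ (L : ℕ) [NeZero L], Even L → L₀ ≤ L →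
    ∃ n : ℕ, (n = statN δ L ∨ n = statN δ L - 2) ∧
      ∃ v : Fock (Orb (FermionTorus 2 L)), v ∈ szSector n 0 ∧ star v ⬝ᵥ v = 1 ∧
        (star v ⬝ᵥ (hubbardTorus 2 L 1 U *ᵥ v)).re ≤
            (hubbardTorus 2 L 1 U).minEnergyOn (szSector n 0) + ε * (L : ℝ) ^ 2 ∧
        c * (L : ℝ) ^ 4 ≤
          (star (pairField dWaveFormFactor L *ᵥ v) ⬝ᵥ (pairField dWaveFormFactor L *ᵥ v)).re

/-- (S3) INTERVAL strengthening of the crux: zero-excess order on an OPEN INTERVAL of dopings ⇒ the floor bridge at SOME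
doping of the interval.  It dodges isolated tangency apices (ideator 4 F2) by fiat, but (i) it is no longer the crux,
(ii) nothing converts density-level information at neighbouring densities into floor-level information at one density
(the floors of different `N` are unrelated by any inequality in the tree or in print), and (iii) it inherits R2′'s cat
exposure (ideator 5 §1) verbatim.  Typed only to make (ii) precise. -/
def IntervalInterchange : Prop :=
  ∀ (U δ₁ δ₂ : ℝ), 0 < U → 0 < δ₁ → δ₁ < δ₂ → δ₂ < 1 / 2 →
    (∀ δ ∈ Set.Ioo δ₁ δ₂, ZeroExcessPairOrder U δ) → ∃ δ ∈ Set.Ioo δ₁ δ₂, FloorBridge U δ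

/-- (S4) ENERGETIC RIGIDITY at `(U, δ)` ("order gap"): eventually, every unit vector of the sector `(N_L, 0)` with small
`d`-wave pair intensity (`≤ c₀ L⁴`) pays an extensive excess `κ L²`.  The only kind of hypothesis under which R1
(`ZeroExcessPairOrder → FloorOrder`) becomes provable — because it CONTAINS floor order (next lemma), making the
zero-excess hypothesis idle.  (NegativeNotesIdeator5 §2: nothing strictly between density-level hypotheses and floor
order exists for R1.) -/
def OrderGapAt (U δ : ℝ) : Prop :=
  ∃ κ : ℝ, 0 < κ ∧ ∃ c₀ : ℝ, 0 < c₀ ∧ ∃ L₀ : ℕ, ∀ (L : ℕ) [NeZero L], Even L → L₀ ≤ L →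
    ∀ v : Fock (Orb (FermionTorus 2 L)), v ∈ szSector (statN δ L) 0 → star v ⬝ᵥ v = 1 →
      (star (pairField dWaveFormFactor L *ᵥ v) ⬝ᵥ (pairField dWaveFormFactor L *ᵥ v)).re ≤ c₀ * (L : ℝ) ^ 4 →
        (hubbardTorus 2 L 1 U).minEnergyOn (szSector (statN δ L) 0) + κ * (L : ℝ) ^ 2 ≤
          (star v ⬝ᵥ (hubbardTorus 2 L 1 U *ᵥ v)).re

/-- S4 trivialises the step it was meant to enable: an order gap forces order on EVERY unit ground state of the sector
(a ground state has excess `0 < κ L²`), in particular `FloorOrder` as soon as the sector has a ground state.  Stated for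
a given ground state to stay free of existence bookkeeping. [folklore] -/
theorem order_of_orderGap_of_groundState (U δ : ℝ) (h : OrderGapAt U δ) :
    ∃ c₀ : ℝ, 0 < c₀ ∧ ∃ L₀ : ℕ, ∀ (L : ℕ) [NeZero L], Even L → L₀ ≤ L →
      ∀ g : Fock (Orb (FermionTorus 2 L)), IsGroundStateInSector (hubbardTorus 2 L 1 U) (statN δ L) 0 g →
        star g ⬝ᵥ g = 1 →
          c₀ * (L : ℝ) ^ 4 < (star (pairField dWaveFormFactor L *ᵥ g) ⬝ᵥ (pairField dWaveFormFactor L *ᵥ g)).re := by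
  obtain ⟨κ, hκ, c₀, hc₀, L₀, hL₀⟩ := h
  refine ⟨c₀, hc₀, L₀, fun L _ hE hL g hg hg1 => ?_⟩
  by_contra hle
  push Not at hle
  have h := hL₀ L hE hL g hg.1 hg1 hle
  have hev := hg.2.2
  have hre : (star g ⬝ᵥ (hubbardTorus 2 L 1 U *ᵥ g)).re =
      (hubbardTorus 2 L 1 U).minEnergyOn (szSector (statN δ L) 0) := by
    rw [hev, dotProduct_smul, hg1, smul_eq_mul, mul_one, Complex.ofReal_re]
  rw [hre] at h
  have hL0 : (0 : ℝ) < (L : ℝ) ^ 2 := by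
    have : (0 : ℝ) < L := by exact_mod_cast Nat.pos_of_ne_zero (NeZero.ne L)
    positivity
  have : 0 < κ * (L : ℝ) ^ 2 := mul_pos hκ hL0
  linarith

/-! ## §4  What the filed crux is, by name (tree theorem, for the record) -/

/-- The filed crux is EXACTLY the conjunction of the two single-layer residues (p127245), re-exported. -/
theorem jmInterchange_iff_residues :
    JmInterchange ↔
      ((∀ (U δ : ℝ), 0 < U → δ ∈ Set.Ioo (0:ℝ) (1 / 2) → ZeroExcessPairOrder U δ → FloorOrder U δ) ∧
        (∀ (U δ : ℝ), 0 < U → δ ∈ Set.Ioo (0:ℝ) (1 / 2) → FloorOrder U δ → FloorBridge U δ)) :=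
  jmInterchange_iff_reachesFloor_and_bridges

end

end Summit.HubbardSuperconductivity.HubbardSuperconductivity.Cruxes.JmInterchange.StrategyCensus
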